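import Literature.NumberTheory.Transcendental.RoySmallValueEstimatesEndgameAssemblyProofs
import Literature.NumberTheory.Transcendental.RoySmallValueEstimates
import HarnessLib

/-!
# Sketch — crux-ideate stmt-Schanuel-1051 (NguyenRoySmallValueTranslates), ideator 2, round 1

First lemmas of the two idea cards, stated (and where cheap, proved) over the EXISTING abstract
endgame structure `Literature.NumberTheory.Transcendental.NguyenRoy.EndgameData σ β ν`
(RoySmallValueEstimatesEndgameAssemblyProofs.lean), which packages §§2–5 of Nguyen–Roy 2016
(arXiv:1412.5163) and from which `false_of_constraints` (= §6) is proved in tree.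

* Card `one-superclose-conjugate`: `superclose_unique` (PROVED here), `exists_concentrated`
  (PROVED here), the predicted statement `NguyenRoyImprovedWindow` and its exponent bookkeeping
  `CaseTwoPrimeExponents` (Props).
* Card `neighbour-level-discount`: `DstarDiscount`, `PtsEqOfMem`, `NguyenRoyNeighbourWindow` (Props).
* Card `upward-persistence-classes`: `UpwardPersistence` (Prop over `EndgameData`).
-/

noncomputable section

open Finset Filter MvPolynomial

namespace Literature.NumberTheory.Transcendental

namespace NguyenRoy

namespace EndgameData

variable {σ β ν : ℝ} (E : EndgameData σ β ν)

/-- **Card 1, first lemma (uniqueness of the super-close conjugate).** Two DISTINCT points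
`a, a'` of the same zero-dimensional `ℚ`-subvariety `Z` (degree `d`, height `h`) which are close
to orbit points `γ_i`, `γ_j` cannot BOTH be closer than the same-cycle Liouville cap
`exp(−(c₁₂ d² + d (h + c₄|j| d) + d (h + c₄|i| d)))/(2 e^{c₁ max(|i|,|j|)})`, unless
`τ^{-i} a = τ^{-j} a'` (a translation-periodicity which in the concrete setting forces `d = 1`,
NR2016 proof of Prop. 14). Proof: `liouville` for the pair of translates `τV (-i) Z`,
`τV (-j) Z` at the points `τ (-i) a`, `τ (-j) a'`, Lemma 11 (`ht_τV_le`), Lemma 5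
(`dist_τ_le`) and the weak triangle inequality through `γ 0`. -/
theorem superclose_unique (Z : E.V) {a a' : E.Pt} (ha : a ∈ E.pts Z) (ha' : a' ∈ E.pts Z)
    (i j : ℤ) (hne : E.τ (-i) a ≠ E.τ (-j) a') :
    Real.exp (-(E.c₁₂ * (E.pts Z).card * (E.pts Z).card
        + (E.pts Z).card * (E.ht Z + E.c₄ * |(j : ℝ)| * (E.pts Z).card)
        + (E.pts Z).card * (E.ht Z + E.c₄ * |(i : ℝ)| * (E.pts Z).card)))
      ≤ 2 * (Real.exp (E.c₁ * |(i : ℝ)|) * E.dist a (E.γ i)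
          + Real.exp (E.c₁ * |(j : ℝ)|) * E.dist a' (E.γ j)) := by
  set b := E.τ (-i) a with hb
  set b' := E.τ (-j) a' with hb'
  have hbm : b ∈ E.pts (E.τV (-i) Z) := E.τ_mem_pts_τV (-i) Z ha
  have hbm' : b' ∈ E.pts (E.τV (-j) Z) := E.τ_mem_pts_τV (-j) Z ha'
  have hL := E.liouville (E.τV (-i) Z) (E.τV (-j) Z) b hbm b' hbm' hne
  rw [E.card_pts_τV, E.card_pts_τV] at hL
  -- heights of the translates
  have hhi := E.ht_τV_le (-i) Z
  have hhj := E.ht_τV_le (-j) Z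
  have habsi : |((-i : ℤ) : ℝ)| = |(i : ℝ)| := by push_cast; rw [abs_neg]
  have habsj : |((-j : ℤ) : ℝ)| = |(j : ℝ)| := by push_cast; rw [abs_neg]
  rw [habsi] at hhi
  rw [habsj] at hhj
  have hd : (0 : ℝ) ≤ (E.pts Z).card := by exact_mod_cast Nat.zero_le _
  -- compare the two exponents
  have hexp : Real.exp (-(E.c₁₂ * (E.pts Z).card * (E.pts Z).card
        + (E.pts Z).card * (E.ht Z + E.c₄ * |(j : ℝ)| * (E.pts Z).card)
        + (E.pts Z).card * (E.ht Z + E.c₄ * |(i : ℝ)| * (E.pts Z).card)))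
      ≤ Real.exp (-(E.c₁₂ * (E.pts Z).card * (E.pts Z).card
        + (E.pts Z).card * E.ht (E.τV (-j) Z) + (E.pts Z).card * E.ht (E.τV (-i) Z))) := by
    apply Real.exp_le_exp.mpr
    have h1 : (E.pts Z).card * E.ht (E.τV (-j) Z)
        ≤ (E.pts Z).card * (E.ht Z + E.c₄ * |(j : ℝ)| * (E.pts Z).card) :=
      mul_le_mul_of_nonneg_left hhj hd
    have h2 : (E.pts Z).card * E.ht (E.τV (-i) Z)
        ≤ (E.pts Z).card * (E.ht Z + E.c₄ * |(i : ℝ)| * (E.pts Z).card) :=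
      mul_le_mul_of_nonneg_left hhi hd
    linarith
  -- distances through γ 0
  have hγi : E.τ (-i) (E.γ i) = E.γ 0 := by rw [E.τ_γ]; simp
  have hγj : E.τ (-j) (E.γ j) = E.γ 0 := by rw [E.τ_γ]; simp
  have hdi : E.dist b (E.γ 0) ≤ Real.exp (E.c₁ * |(i : ℝ)|) * E.dist a (E.γ i) := by
    have := E.dist_τ_le (-i) a (E.γ i)
    rw [hγi, habsi] at this
    exact this
  have hdj : E.dist b' (E.γ 0) ≤ Real.exp (E.c₁ * |(j : ℝ)|) * E.dist a' (E.γ j) := by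
    have := E.dist_τ_le (-j) a' (E.γ j)
    rw [hγj, habsj] at this
    exact this
  have htri : E.dist b b' ≤ 2 * (E.dist b (E.γ 0) + E.dist (E.γ 0) b') := E.dist_triangle _ _ _
  rw [E.dist_comm (E.γ 0) b'] at htri
  calc _ ≤ _ := hexp
    _ ≤ E.dist b b' := hL
    _ ≤ 2 * (E.dist b (E.γ 0) + E.dist b' (E.γ 0)) := htri
    _ ≤ _ := by nlinarith [hdi, hdj]

end EndgameData

/-- **Card 1, second lemma (concentration from a pairwise cap).** If a finite family of real
"closeness" values has every PAIR capped (`min ≤ L`), then all the mass beyond `(n−1)L` sits on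
ONE member. Applied with `f b = −log dist(b, γ_{ι b})` over `pts Z̃_D`, `L` = the cap of
`superclose_unique`, and the Corollary-16 mass, it yields a conjugate with closeness
`≥ (κ D^{1+δ} h + d D^β)/2` as soon as `d ≤ c √(D^{1+δ})`. [folklore] -/
theorem exists_concentrated {α : Type*} [DecidableEq α] (s : Finset α) (hs : s.Nonempty)
    (f : α → ℝ) (L : ℝ) (hcap : ∀ a ∈ s, ∀ b ∈ s, a ≠ b → min (f a) (f b) ≤ L) :
    ∃ a ∈ s, ∑ b ∈ s, f b ≤ f a + ((s.card : ℝ) - 1) * L := by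
  obtain ⟨a, ha, hmax⟩ := s.exists_max_image f hs
  refine ⟨a, ha, ?_⟩
  have hothers : ∀ b ∈ s.erase a, f b ≤ L := by
    intro b hb
    have hbs : b ∈ s := Finset.mem_of_mem_erase hb
    have hba : b ≠ a := Finset.ne_of_mem_erase hb
    have h := hcap a ha b hbs hba.symm
    have : min (f a) (f b) = f b := min_eq_right (hmax b hbs)
    rw [this] at h
    exact h
  have hsum : ∑ b ∈ s, f b = f a + ∑ b ∈ s.erase a, f b := by
    rw [← Finset.add_sum_erase s f ha]
  rw [hsum]
  have hcard : ((s.erase a).card : ℝ) = (s.card : ℝ) - 1 := by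
    rw [Finset.card_erase_of_mem ha]
    have : 1 ≤ s.card := Finset.card_pos.mpr hs
    push_cast [Nat.cast_sub this]
    ring
  have := Finset.sum_le_card_nsmul (s.erase a) f L hothers
  rw [nsmul_eq_mul, hcard] at this
  linarith

/-- **Card 1, predicted statement** (to be proved by the line, NOT assumed): Nguyen–Roy's
Theorem 1 with the correction term `(σ−1)(3−2σ)/(2+β−2σ)` replaced by the SMALLER
`(σ−1)(3/2−σ)/(β+1/2−σ)` on `1 < σ < 3/2` (ratio `(1+β/2−σ)/(β+1/2−σ) ∈ (1/2, 2/3)`),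
i.e. the open window of item stmt-Schanuel-1051 shrunk by a factor between `1/2` and `2/3`.
Same Lean shape as `nguyenRoy2016_thm_1`. [conjecture: this card] -/
def NguyenRoyImprovedWindow : Prop :=
  ∀ (ξ η : ℂ), η ≠ 0 → ∀ (r s : ℚ), r ≠ 0 → s ≠ 0 → s ≠ 1 → s ≠ -1 →
    ∀ (σ β ν : ℝ), 1 < σ → σ < 3 / 2 → σ + 1 < β →
    2 + β - σ + (σ - 1) * (3 / 2 - σ) / (β + 1 / 2 - σ) < ν →
    (∀ᶠ D : ℕ in atTop, ∃ P : MvPolynomial (Fin 2) ℤ, P ≠ 0 ∧ P.totalDegree ≤ D ∧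
      (mvPolyHeight P : ℝ) ≤ Real.exp ((D : ℝ) ^ β) ∧
      ∀ i : ℕ, i < 4 * ⌊(D : ℝ) ^ σ⌋₊ →
        ‖aeval ![ξ + (i : ℂ) * (r : ℂ), η * (s : ℂ) ^ i] P‖ ≤ Real.exp (-(D : ℝ) ^ ν)) →
    IsAlgebraic ℚ ξ ∧ IsAlgebraic ℚ η

/-- **Card 1, cheapest falsifier / exponent bookkeeping of the new Case II′** (analogue of
`case_two_exponent_contradiction'`): with `ν = 2+β−σ+δ`, the two inequalities produced by
§6 Case 2 when the degree lower bound is the concentration threshold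
`deg Z̃_D > c (D*/D)^{σ/2} D^{(1+δ)/2}` instead of `3(D*)^{σ−1}` — namely
`(D*)^{σ−1} ≤ K₁ D^{σ−1−δ}` and `D^{β+1/2−3σ/2+3δ/2} ≤ K₂ (D*)^{2+β−5σ/2}` — cannot hold for
arbitrarily large `D` as soon as `δ > (σ−1)(3/2−σ)/(β+1/2−σ)`. Pure real arithmetic; if this
fails the card's predicted exponent is wrong. [conjecture: this card] -/
def CaseTwoPrimeExponents : Prop :=
  ∀ (σ β δ K₁ K₂ : ℝ), 1 < σ → σ < 3 / 2 → σ + 1 < β → 0 < K₁ → 0 < K₂ →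
    (σ - 1) * (3 / 2 - σ) / (β + 1 / 2 - σ) < δ → δ < σ - 1 →
    ¬ (∃ᶠ D : ℕ in atTop, ∃ Ds : ℕ, 1 ≤ Ds ∧ Ds ≤ D ∧
        (Ds : ℝ) ^ (σ - 1) ≤ K₁ * (D : ℝ) ^ (σ - 1 - δ) ∧
        (D : ℝ) ^ (β + 1 / 2 - 3 / 2 * σ + 3 / 2 * δ) ≤ K₂ * (Ds : ℝ) ^ (2 + β - 5 / 2 * σ))


/-- **Card 2, first lemma (unconditional complexity discount).** For every large level `D` the
auxiliary level `D* = dstar mf D` of §6 satisfies `(D*)^{σ−1} ≤ (8/κ) D^{1+β−ν}`, i.e.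
`D* ≤ (8/κ)^{1/(σ−1)} D^{1−δ/(σ−1)}` with `δ = ν+σ−2−β` — in Case 1 as well as in Case 2:
inequality (II) of `case2_core` is derived from `hstar` WITHOUT the Case-2 hypothesis `hdeglt`
(which enters only inequality (I), line `i3`), and the complementary sub-case (a conjugate with
`|Φʲ P̃_{D*}(α)| ≤ 2e^{−(D*)^ν/2}`) is absurd for `D*` large (`hN₂`). Consequently the bounds
(6.3) pin the complexity of EVERY `Z̃_D` at the scale `D^{1−δ/(σ−1)}`:
`deg Z̃_D ≤ C D^{(2−σ)(1−δ/(σ−1))}`, `ht Z̃_D ≤ C D^{(1+β−σ)(1−δ/(σ−1))}`. Stated for a centring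
`mf` with the Prop. 17 property (as produced by `prop17'`). [conjecture: this card; a refactor of
the proved `case2_core`] -/
def EndgameData.DstarDiscount {σ β ν : ℝ} (E : EndgameData σ β ν) (mf : ℕ → ℕ) : Prop :=
  (∀ D : ℕ, E.D₀ ≤ D → mf D < ⌊(D : ℝ) ^ σ⌋₊ ∧
      ∀ n : ℕ, 1 ≤ n → n ≤ ⌊(D : ℝ) ^ σ⌋₊ →
        ∃ ι : E.Pt → ℤ, (∀ b ∈ E.pts (E.zt mf D), |ι b| < n) ∧
          ∑ b ∈ E.pts (E.zt mf D), Real.log (E.dist b (E.γ (ι b))) ≤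
            -(n * (E.κ / 4) * (D : ℝ) ^ (ν - β - 2) *
              ((D : ℝ) ^ β * (E.pts (E.zt mf D)).card + D * E.ht (E.zt mf D)))) →
  ∀ᶠ D : ℕ in atTop,
    ((E.dstar mf D : ℕ) : ℝ) ^ (σ - 1) ≤ 8 / E.κ * (D : ℝ) ^ (1 + β - ν) ∧
    ((E.pts (E.zt mf D)).card : ℝ) ≤
      2 * E.A₁₄ * ((8 / E.κ) ^ (1 / (σ - 1)) * (D : ℝ) ^ (1 - (ν + σ - 2 - β) / (σ - 1)) + 1)
        ^ (2 - σ) ∧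
    E.ht (E.zt mf D) ≤
      2 * E.B₁₄ * ((8 / E.κ) ^ (1 / (σ - 1)) * (D : ℝ) ^ (1 - (ν + σ - 2 - β) / (σ - 1)) + 1)
        ^ (1 + β - σ)

/-- **Card 2, the near-translate dichotomy it needs as one extra (true, cheap) abstract field**:
two zero-dimensional `ℚ`-subvarieties sharing a point have the same points (in the concrete model
`V = AlgPt`, `pts = conj`, a Galois-conjugacy class). With it, for two levels `D < D' ≤ 2D`:
either some translates `τV i (Z̃_D)`, `τV j (Z̃_{D'})` with `|i|, |j| < 2⌊D'^σ⌋` share their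
point sets ("near-translates"), or every aligned pair of their points is distinct and
`liouville` applies. [conjecture: this card — definition request D1] -/
def EndgameData.PtsEqOfMem {σ β ν : ℝ} (E : EndgameData σ β ν) : Prop :=
  ∀ (Z Z' : E.V) (b : E.Pt), b ∈ E.pts Z → b ∈ E.pts Z' → E.pts Z = E.pts Z'

/-- **Card 2, predicted statement**: Nguyen–Roy's Theorem 1 with the correction term replaced by
`(σ−1)·max( (3−2σ)/(2+β−σ), (4−σ−β)⁺/(3−σ) )` on `1 < σ < 3/2` — the first entry is the printed
one with denominator `2+β−2σ` improved to `2+β−σ`, the second is the translation-drift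
constraint (vacuous for `β ≥ 4−σ`; equal to the printed bound only in the limit `β → σ+1`).
[conjecture: this card] -/
def NguyenRoyNeighbourWindow : Prop :=
  ∀ (ξ η : ℂ), η ≠ 0 → ∀ (r s : ℚ), r ≠ 0 → s ≠ 0 → s ≠ 1 → s ≠ -1 →
    ∀ (σ β ν : ℝ), 1 < σ → σ < 3 / 2 → σ + 1 < β →
    2 + β - σ + (σ - 1) * max ((3 - 2 * σ) / (2 + β - σ)) (max (4 - σ - β) 0 / (3 - σ)) < ν →
    (∀ᶠ D : ℕ in atTop, ∃ P : MvPolynomial (Fin 2) ℤ, P ≠ 0 ∧ P.totalDegree ≤ D ∧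
      (mvPolyHeight P : ℝ) ≤ Real.exp ((D : ℝ) ^ β) ∧
      ∀ i : ℕ, i < 4 * ⌊(D : ℝ) ^ σ⌋₊ →
        ‖aeval ![ξ + (i : ℂ) * (r : ℂ), η * (s : ℂ) ^ i] P‖ ≤ Real.exp (-(D : ℝ) ^ ν)) →
    IsAlgebraic ℚ ξ ∧ IsAlgebraic ℚ η

/-- **Card 3, first lemma (upward persistence)**, abstract form over `EndgameData`: for the good
translates `Z̃_D = zt mf D` of Proposition 17 (any centring function `mf` with the Prop. 17
property), EVERY intermediate level `L` with `C · D^{1 − δ/(σ−1)} < L < D` (`δ = ν+σ−2−β`)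
contains the translate `τ^{⌊L^σ⌋−1} Z̃_D` in `W_L` (`IsIn`). Reason: otherwise `notIn` at level
`L` + Prop. 17 at scale `⌊L^σ⌋` + the bounds (6.3) (which only improve when `D*` is replaced
by `L > D*`) reproduce the Case-2 inequality of §6 with `L` for `D*`, whose height part
`(κ/4)⌊L^σ⌋ D^{ν−β−1} h ≤ L h` is FALSE for `L` above the threshold — an outright contradiction.
NR2016 use only `L = D*`; the levels in between are never looked at. [conjecture: this card] -/
def EndgameData.UpwardPersistence {σ β ν : ℝ} (E : EndgameData σ β ν) (mf : ℕ → ℕ) : Prop :=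
  (∀ D : ℕ, E.D₀ ≤ D → mf D < ⌊(D : ℝ) ^ σ⌋₊ ∧
      ∀ n : ℕ, 1 ≤ n → n ≤ ⌊(D : ℝ) ^ σ⌋₊ →
        ∃ ι : E.Pt → ℤ, (∀ b ∈ E.pts (E.zt mf D), |ι b| < n) ∧
          ∑ b ∈ E.pts (E.zt mf D), Real.log (E.dist b (E.γ (ι b))) ≤
            -(n * (E.κ / 4) * (D : ℝ) ^ (ν - β - 2) *
              ((D : ℝ) ^ β * (E.pts (E.zt mf D)).card + D * E.ht (E.zt mf D)))) →
  ∃ C : ℝ, 0 < C ∧ ∀ᶠ D : ℕ in atTop, ∀ L : ℕ,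
    C * (D : ℝ) ^ (1 - (ν + σ - 2 - β) / (σ - 1)) < L → L < D →
      E.IsIn (E.τV ((⌊(L : ℝ) ^ σ⌋₊ : ℤ) - 1) (E.zt mf D)) L

end NguyenRoy

end Literature.NumberTheory.Transcendental

end
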